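import Summits.QuantumFields.YangMills.Theorems.UnitScaleTiltFluctuationComparisonRegPrAnsatzTRowBound
import Summits.QuantumFields.YangMills.Theorems.UnitScaleTiltFluctuationComparisonRegPrCertL3Clause

/-!
# Route `UnitScaleTilt` — crux K1bR-pr `FluctuationComparisonRegPrL` (stmt-QuantumFields-19935, ex 19201): **STUB 1 `stub_oneStepSmallLift`
# BY NAME** — the registered signature, from the `L = 3` certificate clause (fleet lane, `CertL3Tree.certL3_clause`, p1 g11) and the
# per-`L` clauses at every odd `L ≥ 5` (ANSATZ S at `L = 5`, ANSATZ T + the Γ-leg interior assembly at `L ≥ 7`)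
# (stub file `--supports stmt-QuantumFields-19935`; computational: the `L = 3` clause rests on `native_decide` certificate facts)

Cell `ym3-torus` (HUMAN RULING D-0037, rung R3), seat `ym3-torus-p2` gen 10.  Three lineages meet here: the fleet's face pipeline
(ym-ust-19201-p1: `LiftFace*`, `CertL3Tree`), this seat's kernel data (ANSATZ S `…AnsatzS*`, ANSATZ T `…AnsatzT*` = the gen-9 tensor lift of
IR-NODE §16 in tree coordinates), and ym3-torus-p1 g11's Γ-leg accuracy layer and interior assembly (`LiftLegs*`).  One line.
-/

noncomputable section

namespace Summit.QuantumFields.YangMills.Theorems.ApproxLift.AnsatzT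

open Literature.MathematicalPhysics.QuantumFieldTheory.Balaban1983to89
open Literature.MathematicalPhysics.QuantumFieldTheory.Balaban1983to89.T3ContinuumYM3Torus
open Literature.MathematicalPhysics.QuantumFieldTheory.Balaban1983to89.T3UnitLawDensityEML (ℰp)
open Literature.MathematicalPhysics.QuantumFieldTheory.Balaban1983to89.T3SmallLiftHistory (OneStepSmallLift)

/-- **STUB 1 (L; W7) OF `FluctuationComparisonRegPrL` — ONE-STEP SMALL LIFT with gain `κ√L ≤ 1` for every family of block size `L`**
(the registered signature of `stub_oneStepSmallLift`, stmt-QuantumFields-19935): `L = 3` by the certified face-supported table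
(`CertL3Tree.certL3_clause`), every odd `L ≥ 5` by `perL_clause_all` (ANSATZ S / ANSATZ T), all other `L` carry no `T3Family`
(`oneStepSmallLift_stub_of_perL`, via «exactness is free» `oneStepSmallLift_stub_of_approx`). [cite: Balaban1987RG1, (0.4)/(0.18) p.253] -/
theorem stub_oneStepSmallLift :
    ∀ L : ℕ, ∃ κ δ₀ : ℝ, κ * Real.sqrt L ≤ 1 ∧ 0 < δ₀ ∧
      ∀ F : T3Family, F.L = L → OneStepSmallLift F ℰp κ δ₀ :=
  oneStepSmallLift_stub_of_certL3 CertL3Tree.certL3_clause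

end Summit.QuantumFields.YangMills.Theorems.ApproxLift.AnsatzT

end
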